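import Mathlib
import Summits.KontsevichZagierPeriods.Zeta5Search.DualSeriesNineDenominators
import HarnessLib.Audit
import HarnessLib

/-!
# `F̃₉(b)`: the rank-3 elimination `Λ = Q·ζ(5) − P` (PROVED), its generic denominators (PROVED), and the `k = 9`
# big-prime window laws (W)₉ / (U)₉ / (S)₉ (CONJECTURES, exact finite evidence) — cell `pub-zeta5`, `fam-vwp` gen 4

HONEST FRAMING: systematic search; no irrationality claim unless certified.

Provenance: written by the family-designer seat `pub-zeta5-fam-vwp-g4` (planner role, no stage permission; staged
`run/shared/lean/pub/pub-zeta5/lean/fam-vwp/DualSeriesNineMinors.lean`, result-of-record `families/vwp/FAMILY.md` §12), for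
VERBATIM filing by the lane.  It types the `T1` object of the very-well-poised class `vwp` at `k = 9` over PROVER 3's layer
(`DualSeriesNineCoefficients.lean`: `coeff7/5/3/0`, `vwp9_decomposition`; `DualSeriesNineDenominators.lean`: `normaliser9`,
`exists_int_data9`, `coeff7_den` …) and records, as `@[conjecture] def`s with their exact evidence, the `k = 9` analogues of the
typer's PROVED `k = 7` big-prime window theorems (`BigPrimeBelowB0.one_le_padicValRat_coeffW/U_of_slot`,
`BigPrimeWindow.one_le_padicValRat_coeffW/U_of_slots`).  Nothing here is literature; nothing here is about irrationality.

## 1. PROVED — the rank-3 elimination (the `T1` form of class `vwp`, `families/vwp/FAMILY.md` §5, §9 (vii), §11.2)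
Three parameter vectors `b¹, b², b³` on the box (`InBox`, `Σ_j b_j ≤ 4b₀ + 2`) give three forms
`F̃₉(bⁱ) = coeff7 bⁱ·ζ(7) + coeff5 bⁱ·ζ(5) + coeff3 bⁱ·ζ(3) − coeff0 bⁱ` (`vwp9_decomposition`).  The cofactor combination
along the (`ζ(7)`, `ζ(3)`) columns kills both: with `C(b,b') = coeff7 b·coeff3 b' − coeff7 b'·coeff3 b` (`cof9`),
`minor_form9`:  `C(b³,b²)·F̃₉(b¹) + C(b¹,b³)·F̃₉(b²) + C(b²,b¹)·F̃₉(b³) = Q·ζ(5) − P`,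
`Q = det[coeff7 bⁱ, coeff5 bⁱ, coeff3 bⁱ]` (`minorQ9`), `P = det[coeff7 bⁱ, coeff0 bⁱ, coeff3 bⁱ]` (`minorP9`) — pure linear
algebra over the decomposition (no independence of zeta values is used).  Along a ray `n·β` (`minor_form9_ray`; kernel
instance `minor_form9_ray_three_ones` for fam-vwp's RAY 1 `β = (3;1⁹)` and ANY `n₁, n₂, n₃`) this is the `n`-Casoratian pair
`(Q, P)` whose exact rates are tabulated in FAMILY.md §11.2.

## 2. PROVED — generic denominators of `(Q, P)`
`coeff7_den'`, `coeff5_den'`, `coeff3_den'`, `coeff0_den'`: PROVER 3's `d·N₉·coeff7 ∈ ℤ`, `d³·N₉·coeff5 ∈ ℤ`,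
`d⁵·N₉·coeff3 ∈ ℤ`, `d⁸·N₉·coeff0 ∈ ℤ` for ANY common multiple `d` of `1, …, b₀` (their file fixes `d = d_{b₀}`; the proofs are
theirs verbatim with `d` free), hence for a common multiple `d` of `1, …, max_i b₀ⁱ` (`minorQ9_den`, `minorP9_den`):
`d⁹ · N₉(b¹)N₉(b²)N₉(b³) · Q ∈ ℤ` and `d¹⁴ · N₉(b¹)N₉(b²)N₉(b³) · P ∈ ℤ`.  This is the GENERIC (Rivoal-brick) strength only.
The OBSERVED lcm class of `(Q, P)` on the rays is far smaller (FAMILY.md §4, §6, §11.2: EXACT tables), and even granting it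
the class is not worthy: `γ ≤ 0.51 < 0.86597` (FAMILY.md §0, §11; lane result `ttrl/zeta5-calc/vwp/BOX9-MODEL.md`).  No size,
rate or worthiness statement is made in this file.

## 3. CONJECTURES (W)₉ / (U)₉ / (S)₉ — `k = 9` big-prime windows (`BigPrime9Zeta3/5/7`; OBSERVED-EXACT, not proved)
Write `d₉(b) = 4b₀ − Σ_{j=1}^{9} b_j` (`dNine`) and `b₍₁₎ ≤ b₍₂₎ ≤ b₍₃₎` for the three smallest of `b₁, …, b₉`.  On the
Brown–Zudilin polytope (`0 ≤ 2b_j ≤ b₀`, `Σ b_j ≤ 4b₀`), for primes `p` with `b₀ + 1 ≤ p + b₍₂₎ + b₍₃₎` (typed with slots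
`j₁, j₂, j₃` exactly as in the `k = 7` theorems):
  (W)₉ `p ≥ 7`, `p ≤ d₉+1`  ⟹ `v_p(coeff3 b) ≥ 1`;   (U)₉ `p ≥ 5`, `2p ≤ d₉+1` ⟹ `v_p(coeff5 b) ≥ 1`;
  (S)₉ `p ≥ 5`, `3p ≤ d₉+1` ⟹ `v_p(coeff7 b) ≥ 1`.
EVIDENCE (EXACT rational arithmetic, `pub-zeta5-fam-vwp/g4/bigprime9.py`, engine `vwpB.linear_form` = partial fractions of
Brown–Zudilin's (34), whose order-`o` coefficient sums ARE `coeff_{o+1}` by `IsPFData9.eq`; outputs `bp9_a/b/c.json`):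
791 parameter vectors (`b₀ ≤ 120`, `d₉ ≤ 161`: the rays `(3;1⁹)·n (n ≤ 30)`, `(5;2⁹)·n (n ≤ 16)`, `(12;5⁸,1)·n`, `(28;11⁸,1)·n`,
`(30;13⁸,1)·n`, `(20;9,9,8,8,7,7,6,6,5)·n`, `(13;5,5,4,4,3,3,2,2,1)·n`, `(16;7,6,6,5,5,4,4,3,3)·n`, `(8;3⁸,2)·n`, 60 random interior
points, 505 points `(b₀;s⁸,t)` with a non-empty (S)₉ window, 140 points `(b₀;g⁷,m,t)` with primes strictly between the
level-2 and level-1 lower ends, 108 boundary points `Σ b_j = 4b₀` (all windows empty there)):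
  (W)₉ 7922 pairs `(b,p)` on 788 vectors, 0 failures;  (U)₉ 2446 pairs on 656 vectors, 0 failures;  (S)₉ 726 pairs on 524
  vectors, 0 failures;  of these 434 / 66 / 8 pairs lie strictly below the level-1 end `b₀ + 1 − 2b₍₂₎` (all hold).
SHARPNESS (same data): the next prime above the upper end fails to divide in 558/788 (W)₉, 600/656 (U)₉, 460/524 (S)₉ of
the vectors — the ends `d₉+1`, `(d₉+1)/2`, `(d₉+1)/3` are attained generically; `p = 5` FAILS (W)₉ in 6 of its 21 would-be
instances (`(6;2⁹)`, `(12;4⁹)`, `(10;4⁹)`, `(12;5⁸,1)`, `(8;3⁸,2)`, `(16;6⁸,4)`), so `p ≥ 7` is necessary (at `k = 7` the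
proved threshold is `5`: the pole order rises from `6` to `8`); `p = 3` fails (U)₉ in 2 of 3.  CALIBRATION: the same script at
`k = 7` reproduces the PROVED windows on 6 vectors incl. the Brown–Zudilin record `(41;17,…,11)` (window `[17, 26]`), 0
deviations (`bp7_cal.json`).  HEURISTIC for a typer: the `k = 7` proof (`BigPrimeBelowB0`: support `S = [b_{j₂}, b₀ − b_{j₂}]`,
`P_S^6·M^S = Ñ·(X^p − X)^6`, degree bound ⟹ `Σ_{x∈𝔽_p}[X^3]M^S(X+x) = 0` iff `p ≤ d+1`) becomes `(X^p − X)^8` with the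
coefficients `[X^5] / [X^3] / [X^1]` for `ζ(3) / ζ(5) / ζ(7)`, giving exactly the three observed ends.  NOT PROVED HERE.

Nearest printed relative (as for `k = 7`, lead/lit LITERATURE §I.33): Krattenthaler–Rivoal 2007, Thms 3–6 (primes above the
pole range dividing coefficients of symmetric very-well-poised series); the windows BELOW `b₀` for general `b` are the cell's.
-/

noncomputable section

open Finset

namespace Summit.KontsevichZagierPeriods.Zeta5Search

namespace DualSeriesNineMinors

open DualSeriesNine (InBox IsPFData9 coeff7 coeff5 coeff3 coeff0 coeff7_eq coeff5_eq coeff3_eq coeff0_eq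
  vwp9_decomposition inBox9_nsmul sum9_nsmul_le base9 ray9)
open DualSeriesNineDenominators (pfst9 psnd9 normaliser9 exists_int_data9)
open DualSeriesDenominators (bn natCast_dvd_lcmUpto)
open Literature.NumberTheory.Irrationality.BrownZudilin2022 (vwpDual)
open Literature.NumberTheory.Transcendental (zetaValue)
open Literature.NumberTheory.Transcendental.BallRivoal (harm isInt_dpow_mul_harm)

/-! ### 1. The rank-3 elimination `Λ = Q·ζ(5) − P` -/

/-- The `2 × 2` cofactor on the (`ζ(7)`, `ζ(3)`) columns: `C(b, b') = coeff7 b · coeff3 b' − coeff7 b' · coeff3 b`. -/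
def cof9 (b b' : ℕ → ℤ) : ℚ := coeff7 b * coeff3 b' - coeff7 b' * coeff3 b

/-- `Q(b¹,b²,b³) = det [coeff7 bⁱ, coeff5 bⁱ, coeff3 bⁱ]_{i=1,2,3}`: the `ζ(5)`-coefficient of the elimination `Λ`. -/
def minorQ9 (b₁ b₂ b₃ : ℕ → ℤ) : ℚ :=
  Matrix.det !![coeff7 b₁, coeff5 b₁, coeff3 b₁; coeff7 b₂, coeff5 b₂, coeff3 b₂; coeff7 b₃, coeff5 b₃, coeff3 b₃]

/-- `P(b¹,b²,b³) = det [coeff7 bⁱ, coeff0 bⁱ, coeff3 bⁱ]_{i=1,2,3}`: the rational part of the elimination `Λ = Q·ζ(5) − P`. -/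
def minorP9 (b₁ b₂ b₃ : ℕ → ℤ) : ℚ :=
  Matrix.det !![coeff7 b₁, coeff0 b₁, coeff3 b₁; coeff7 b₂, coeff0 b₂, coeff3 b₂; coeff7 b₃, coeff0 b₃, coeff3 b₃]

/-- Expansion of `Q` along its middle column: `Q = C(b³,b²)·coeff5 b¹ + C(b¹,b³)·coeff5 b² + C(b²,b¹)·coeff5 b³`. -/
theorem minorQ9_eq (b₁ b₂ b₃ : ℕ → ℤ) :
    minorQ9 b₁ b₂ b₃ = cof9 b₃ b₂ * coeff5 b₁ + cof9 b₁ b₃ * coeff5 b₂ + cof9 b₂ b₁ * coeff5 b₃ := by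
  rw [minorQ9, Matrix.det_fin_three]
  simp only [cof9, Matrix.of_apply, Matrix.cons_val', Matrix.cons_val_zero, Matrix.cons_val_one,
    Matrix.cons_val_two, Matrix.empty_val', Matrix.cons_val_fin_one, Matrix.head_cons, Matrix.tail_cons,
    Matrix.head_fin_const]
  ring

/-- Expansion of `P` along its middle column: `P = C(b³,b²)·coeff0 b¹ + C(b¹,b³)·coeff0 b² + C(b²,b¹)·coeff0 b³`. -/
theorem minorP9_eq (b₁ b₂ b₃ : ℕ → ℤ) :
    minorP9 b₁ b₂ b₃ = cof9 b₃ b₂ * coeff0 b₁ + cof9 b₁ b₃ * coeff0 b₂ + cof9 b₂ b₁ * coeff0 b₃ := by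
  rw [minorP9, Matrix.det_fin_three]
  simp only [cof9, Matrix.of_apply, Matrix.cons_val', Matrix.cons_val_zero, Matrix.cons_val_one,
    Matrix.cons_val_two, Matrix.empty_val', Matrix.cons_val_fin_one, Matrix.head_cons, Matrix.tail_cons,
    Matrix.head_fin_const]
  ring

/-- The cofactors kill the `ζ(7)`-column: `Σ_i C_i · coeff7 bⁱ = 0` (a determinant with two equal columns). -/
theorem cof9_sum_coeff7 (b₁ b₂ b₃ : ℕ → ℤ) :
    cof9 b₃ b₂ * coeff7 b₁ + cof9 b₁ b₃ * coeff7 b₂ + cof9 b₂ b₁ * coeff7 b₃ = 0 := by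
  simp only [cof9]; ring

/-- The cofactors kill the `ζ(3)`-column: `Σ_i C_i · coeff3 bⁱ = 0`. -/
theorem cof9_sum_coeff3 (b₁ b₂ b₃ : ℕ → ℤ) :
    cof9 b₃ b₂ * coeff3 b₁ + cof9 b₁ b₃ * coeff3 b₂ + cof9 b₂ b₁ * coeff3 b₃ = 0 := by
  simp only [cof9]; ring

/-- **THE RANK-3 ELIMINATION (PROVED).**  For `b¹, b², b³` on the box with `Σ_j b_j ≤ 4b₀ + 2` (so that
`vwp9_decomposition` applies to each), the cofactor combination of the three dual series is a form in `1, ζ(5)` alone: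
`C(b³,b²)·F̃₉(b¹) + C(b¹,b³)·F̃₉(b²) + C(b²,b¹)·F̃₉(b³) = Q·ζ(5) − P`. -/
theorem minor_form9 (b₁ b₂ b₃ : ℕ → ℤ) (h₁ : InBox b₁) (h₂ : InBox b₂) (h₃ : InBox b₃)
    (hs₁ : ∑ j ∈ range 9, b₁ (j + 1) ≤ 4 * b₁ 0 + 2) (hs₂ : ∑ j ∈ range 9, b₂ (j + 1) ≤ 4 * b₂ 0 + 2)
    (hs₃ : ∑ j ∈ range 9, b₃ (j + 1) ≤ 4 * b₃ 0 + 2) :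
    (cof9 b₃ b₂ : ℝ) * vwpDual 9 b₁ + (cof9 b₁ b₃ : ℝ) * vwpDual 9 b₂ + (cof9 b₂ b₁ : ℝ) * vwpDual 9 b₃ =
      (minorQ9 b₁ b₂ b₃ : ℝ) * zetaValue 5 - (minorP9 b₁ b₂ b₃ : ℝ) := by
  rw [(vwp9_decomposition b₁ h₁ hs₁).2, (vwp9_decomposition b₂ h₂ hs₂).2, (vwp9_decomposition b₃ h₃ hs₃).2,
    minorQ9_eq, minorP9_eq]
  simp only [cof9]
  push_cast
  ring

/-- **Along a ray `n·β`** (`0 ≤ β₀`, `0 ≤ β_j ≤ β₀`, `Σ_j β_j ≤ 4β₀`): for ANY `n₁, n₂, n₃` the elimination of the three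
forms `F̃₉(n₁β), F̃₉(n₂β), F̃₉(n₃β)` is `Q·ζ(5) − P` (the `n`-Casoratian pair of `families/vwp/FAMILY.md` §11.2 is
`(n₁,n₂,n₃) = (n, n−1, n−2)`). -/
theorem minor_form9_ray (β : Fin 10 → ℤ) (h0 : 0 ≤ base9 β 0)
    (hb : ∀ j ∈ range 9, 0 ≤ base9 β (j + 1) ∧ base9 β (j + 1) ≤ base9 β 0)
    (hsum : ∑ j ∈ range 9, base9 β (j + 1) ≤ 4 * base9 β 0) (n₁ n₂ n₃ : ℕ) :
    (cof9 (ray9 β n₃) (ray9 β n₂) : ℝ) * vwpDual 9 (ray9 β n₁) +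
        (cof9 (ray9 β n₁) (ray9 β n₃) : ℝ) * vwpDual 9 (ray9 β n₂) +
        (cof9 (ray9 β n₂) (ray9 β n₁) : ℝ) * vwpDual 9 (ray9 β n₃) =
      (minorQ9 (ray9 β n₁) (ray9 β n₂) (ray9 β n₃) : ℝ) * zetaValue 5 -
        (minorP9 (ray9 β n₁) (ray9 β n₂) (ray9 β n₃) : ℝ) :=
  minor_form9 _ _ _ (inBox9_nsmul _ h0 hb n₁) (inBox9_nsmul _ h0 hb n₂) (inBox9_nsmul _ h0 hb n₃)
    (sum9_nsmul_le _ hsum n₁) (sum9_nsmul_le _ hsum n₂) (sum9_nsmul_le _ hsum n₃)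

/-- Kernel instance: fam-vwp's RAY 1 `β = (3;1⁹)` — for ANY `n₁, n₂, n₃` the elimination of
`F̃₉(n₁β), F̃₉(n₂β), F̃₉(n₃β)` is `Q·ζ(5) − P` (ray hypotheses by `decide`). -/
theorem minor_form9_ray_three_ones (n₁ n₂ n₃ : ℕ) :
    (cof9 (ray9 ![3, 1, 1, 1, 1, 1, 1, 1, 1, 1] n₃) (ray9 ![3, 1, 1, 1, 1, 1, 1, 1, 1, 1] n₂) : ℝ) *
          vwpDual 9 (ray9 ![3, 1, 1, 1, 1, 1, 1, 1, 1, 1] n₁) +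
        (cof9 (ray9 ![3, 1, 1, 1, 1, 1, 1, 1, 1, 1] n₁) (ray9 ![3, 1, 1, 1, 1, 1, 1, 1, 1, 1] n₃) : ℝ) *
          vwpDual 9 (ray9 ![3, 1, 1, 1, 1, 1, 1, 1, 1, 1] n₂) +
        (cof9 (ray9 ![3, 1, 1, 1, 1, 1, 1, 1, 1, 1] n₂) (ray9 ![3, 1, 1, 1, 1, 1, 1, 1, 1, 1] n₁) : ℝ) *
          vwpDual 9 (ray9 ![3, 1, 1, 1, 1, 1, 1, 1, 1, 1] n₃) =
      (minorQ9 (ray9 ![3, 1, 1, 1, 1, 1, 1, 1, 1, 1] n₁) (ray9 ![3, 1, 1, 1, 1, 1, 1, 1, 1, 1] n₂)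
          (ray9 ![3, 1, 1, 1, 1, 1, 1, 1, 1, 1] n₃) : ℝ) * zetaValue 5 -
        (minorP9 (ray9 ![3, 1, 1, 1, 1, 1, 1, 1, 1, 1] n₁) (ray9 ![3, 1, 1, 1, 1, 1, 1, 1, 1, 1] n₂)
          (ray9 ![3, 1, 1, 1, 1, 1, 1, 1, 1, 1] n₃) : ℝ) :=
  minor_form9_ray _ (by decide) (by decide) (by decide) n₁ n₂ n₃

/-! ### 2. Generic denominators: `d` any common multiple of `1, …, b₀` -/

/-- `d^{7−o}·N₉(b)·Σ_p c_{o,p} ∈ ℤ` for ANY common multiple `d` of `1, …, b₀` (general-`d` form of PROVER 3's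
`sum_order_den`, same proof). -/
theorem sum_order_den' {b : ℕ → ℤ} (hb : InBox b)
    (hP : ∀ s, s < 8 → bn b (pfst9 s) + bn b (psnd9 s) ≤ bn b 0)
    (hsum : ∑ j ∈ range 9, b (j + 1) ≤ 4 * b 0 + 2) (d : ℕ)
    (hdiv : ∀ k : ℕ, 1 ≤ k → k ≤ bn b 0 → (k : ℤ) ∣ d) (o : ℕ) (ho : o < 8) :
    ∃ c : ℕ → ℕ → ℚ, IsPFData9 b c ∧ ∃ z : ℤ,
      (d : ℚ) ^ (7 - o) * (normaliser9 b : ℚ) * ∑ p ∈ range (bn b 0 + 1), c o p = z := by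
  obtain ⟨c, hc, hint⟩ := exists_int_data9 hb hP hsum d hdiv
  have hterm : ∀ p ∈ range (bn b 0 + 1), ∃ z : ℤ, (d : ℚ) ^ (7 - o) * (normaliser9 b : ℚ) * c o p = z := by
    intro p hp
    obtain ⟨z, hz⟩ := hint o p ho (Nat.lt_succ_iff.1 (mem_range.1 hp))
    exact ⟨z, by rw [← hz]; ring⟩
  choose z hz using hterm
  refine ⟨c, hc, ∑ p ∈ (range (bn b 0 + 1)).attach, z p.1 p.2, ?_⟩
  rw [mul_sum, ← sum_attach]
  push_cast
  exact sum_congr rfl fun p _ => hz p.1 p.2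

/-- **`d · N₉(b) · coeff7 b ∈ ℤ`** for any common multiple `d` of `1, …, b₀`. -/
theorem coeff7_den' {b : ℕ → ℤ} (hb : InBox b)
    (hP : ∀ s, s < 8 → bn b (pfst9 s) + bn b (psnd9 s) ≤ bn b 0)
    (hsum : ∑ j ∈ range 9, b (j + 1) ≤ 4 * b 0 + 2) (d : ℕ)
    (hdiv : ∀ k : ℕ, 1 ≤ k → k ≤ bn b 0 → (k : ℤ) ∣ d) :
    ∃ z : ℤ, (d : ℚ) * (normaliser9 b : ℚ) * coeff7 b = z := by
  obtain ⟨c, hc, z, hz⟩ := sum_order_den' hb hP hsum d hdiv 6 (by norm_num)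
  refine ⟨z, ?_⟩
  rw [coeff7_eq hc, show (b 0).toNat = bn b 0 from rfl, ← hz, show (7 : ℕ) - 6 = 1 from rfl, pow_one]

/-- **`d³ · N₉(b) · coeff5 b ∈ ℤ`** for any common multiple `d` of `1, …, b₀`. -/
theorem coeff5_den' {b : ℕ → ℤ} (hb : InBox b)
    (hP : ∀ s, s < 8 → bn b (pfst9 s) + bn b (psnd9 s) ≤ bn b 0)
    (hsum : ∑ j ∈ range 9, b (j + 1) ≤ 4 * b 0 + 2) (d : ℕ)
    (hdiv : ∀ k : ℕ, 1 ≤ k → k ≤ bn b 0 → (k : ℤ) ∣ d) :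
    ∃ z : ℤ, (d : ℚ) ^ 3 * (normaliser9 b : ℚ) * coeff5 b = z := by
  obtain ⟨c, hc, z, hz⟩ := sum_order_den' hb hP hsum d hdiv 4 (by norm_num)
  refine ⟨z, ?_⟩
  rw [coeff5_eq hc, show (b 0).toNat = bn b 0 from rfl, ← hz, show (7 : ℕ) - 4 = 3 from rfl]

/-- **`d⁵ · N₉(b) · coeff3 b ∈ ℤ`** for any common multiple `d` of `1, …, b₀`. -/
theorem coeff3_den' {b : ℕ → ℤ} (hb : InBox b)
    (hP : ∀ s, s < 8 → bn b (pfst9 s) + bn b (psnd9 s) ≤ bn b 0)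
    (hsum : ∑ j ∈ range 9, b (j + 1) ≤ 4 * b 0 + 2) (d : ℕ)
    (hdiv : ∀ k : ℕ, 1 ≤ k → k ≤ bn b 0 → (k : ℤ) ∣ d) :
    ∃ z : ℤ, (d : ℚ) ^ 5 * (normaliser9 b : ℚ) * coeff3 b = z := by
  obtain ⟨c, hc, z, hz⟩ := sum_order_den' hb hP hsum d hdiv 2 (by norm_num)
  refine ⟨z, ?_⟩
  rw [coeff3_eq hc, show (b 0).toNat = bn b 0 from rfl, ← hz, show (7 : ℕ) - 2 = 5 from rfl]

/-- **`d⁸ · N₉(b) · coeff0 b ∈ ℤ`** for any common multiple `d` of `1, …, b₀` (general-`d` form of PROVER 3's `coeff0_den`,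
same proof: the truncated zeta sums `H_p^{(o+1)}` are cleared by `d^{o+1}`, `BallRivoal.isInt_dpow_mul_harm`). -/
theorem coeff0_den' {b : ℕ → ℤ} (hb : InBox b)
    (hP : ∀ s, s < 8 → bn b (pfst9 s) + bn b (psnd9 s) ≤ bn b 0)
    (hsum : ∑ j ∈ range 9, b (j + 1) ≤ 4 * b 0 + 2) (d : ℕ)
    (hdiv : ∀ k : ℕ, 1 ≤ k → k ≤ bn b 0 → (k : ℤ) ∣ d) :
    ∃ z : ℤ, (d : ℚ) ^ 8 * (normaliser9 b : ℚ) * coeff0 b = z := by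
  obtain ⟨c, hc, hint⟩ := exists_int_data9 hb hP hsum d hdiv
  have hterm : ∀ o ∈ range 8, ∀ p ∈ range (bn b 0 + 1), ∃ z : ℤ,
      (d : ℚ) ^ 8 * (normaliser9 b : ℚ) * (c o p * harm (o + 1) p) = z := by
    intro o ho p hp
    have ho' := mem_range.1 ho
    have hp' := Nat.lt_succ_iff.1 (mem_range.1 hp)
    obtain ⟨z, hz⟩ := hint o p ho' hp'
    obtain ⟨w, hw⟩ := isInt_dpow_mul_harm (bn b 0) d hdiv (o + 1) p hp'
    refine ⟨z * w, ?_⟩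
    have e : (8 : ℕ) = (7 - o) + (o + 1) := by omega
    rw [e, pow_add]
    push_cast
    rw [← hz, ← hw]
    ring
  choose z hz using hterm
  refine ⟨∑ o ∈ (range 8).attach, ∑ p ∈ (range (bn b 0 + 1)).attach, z o.1 o.2 p.1 p.2, ?_⟩
  rw [coeff0_eq hc, show (b 0).toNat = bn b 0 from rfl, mul_sum, ← sum_attach]
  push_cast
  refine sum_congr rfl fun o _ => ?_
  rw [mul_sum, ← sum_attach]
  exact sum_congr rfl fun p _ => hz o.1 o.2 p.1 p.2

/-- **Generic denominator of `Q` (PROVED): `d⁹ · N₉(b¹)N₉(b²)N₉(b³) · Q ∈ ℤ`** for `d` any common multiple of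
`1, …, b₀ⁱ` (`i = 1,2,3`), on the box with the eight pair conditions (`1 + 3 + 5 = 9`). -/
theorem minorQ9_den {b₁ b₂ b₃ : ℕ → ℤ} (h₁ : InBox b₁) (h₂ : InBox b₂) (h₃ : InBox b₃)
    (hP₁ : ∀ s, s < 8 → bn b₁ (pfst9 s) + bn b₁ (psnd9 s) ≤ bn b₁ 0)
    (hP₂ : ∀ s, s < 8 → bn b₂ (pfst9 s) + bn b₂ (psnd9 s) ≤ bn b₂ 0)
    (hP₃ : ∀ s, s < 8 → bn b₃ (pfst9 s) + bn b₃ (psnd9 s) ≤ bn b₃ 0)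
    (hs₁ : ∑ j ∈ range 9, b₁ (j + 1) ≤ 4 * b₁ 0 + 2) (hs₂ : ∑ j ∈ range 9, b₂ (j + 1) ≤ 4 * b₂ 0 + 2)
    (hs₃ : ∑ j ∈ range 9, b₃ (j + 1) ≤ 4 * b₃ 0 + 2) (d : ℕ)
    (hd₁ : ∀ k : ℕ, 1 ≤ k → k ≤ bn b₁ 0 → (k : ℤ) ∣ d) (hd₂ : ∀ k : ℕ, 1 ≤ k → k ≤ bn b₂ 0 → (k : ℤ) ∣ d)
    (hd₃ : ∀ k : ℕ, 1 ≤ k → k ≤ bn b₃ 0 → (k : ℤ) ∣ d) :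
    ∃ z : ℤ, (d : ℚ) ^ 9 * ((normaliser9 b₁ : ℚ) * normaliser9 b₂ * normaliser9 b₃) * minorQ9 b₁ b₂ b₃ = z := by
  obtain ⟨u₁, hu₁⟩ := coeff7_den' h₁ hP₁ hs₁ d hd₁
  obtain ⟨u₂, hu₂⟩ := coeff7_den' h₂ hP₂ hs₂ d hd₂
  obtain ⟨u₃, hu₃⟩ := coeff7_den' h₃ hP₃ hs₃ d hd₃
  obtain ⟨w₁, hw₁⟩ := coeff5_den' h₁ hP₁ hs₁ d hd₁
  obtain ⟨w₂, hw₂⟩ := coeff5_den' h₂ hP₂ hs₂ d hd₂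
  obtain ⟨w₃, hw₃⟩ := coeff5_den' h₃ hP₃ hs₃ d hd₃
  obtain ⟨x₁, hx₁⟩ := coeff3_den' h₁ hP₁ hs₁ d hd₁
  obtain ⟨x₂, hx₂⟩ := coeff3_den' h₂ hP₂ hs₂ d hd₂
  obtain ⟨x₃, hx₃⟩ := coeff3_den' h₃ hP₃ hs₃ d hd₃
  refine ⟨(u₃ * x₂ - u₂ * x₃) * w₁ + (u₁ * x₃ - u₃ * x₁) * w₂ + (u₂ * x₁ - u₁ * x₂) * w₃, ?_⟩
  rw [minorQ9_eq]
  push_cast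
  rw [← hu₁, ← hu₂, ← hu₃, ← hw₁, ← hw₂, ← hw₃, ← hx₁, ← hx₂, ← hx₃]
  simp only [cof9]
  ring

/-- **Generic denominator of `P` (PROVED): `d¹⁴ · N₉(b¹)N₉(b²)N₉(b³) · P ∈ ℤ`** (`1 + 8 + 5 = 14`), same hypotheses. -/
theorem minorP9_den {b₁ b₂ b₃ : ℕ → ℤ} (h₁ : InBox b₁) (h₂ : InBox b₂) (h₃ : InBox b₃)
    (hP₁ : ∀ s, s < 8 → bn b₁ (pfst9 s) + bn b₁ (psnd9 s) ≤ bn b₁ 0)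
    (hP₂ : ∀ s, s < 8 → bn b₂ (pfst9 s) + bn b₂ (psnd9 s) ≤ bn b₂ 0)
    (hP₃ : ∀ s, s < 8 → bn b₃ (pfst9 s) + bn b₃ (psnd9 s) ≤ bn b₃ 0)
    (hs₁ : ∑ j ∈ range 9, b₁ (j + 1) ≤ 4 * b₁ 0 + 2) (hs₂ : ∑ j ∈ range 9, b₂ (j + 1) ≤ 4 * b₂ 0 + 2)
    (hs₃ : ∑ j ∈ range 9, b₃ (j + 1) ≤ 4 * b₃ 0 + 2) (d : ℕ)
    (hd₁ : ∀ k : ℕ, 1 ≤ k → k ≤ bn b₁ 0 → (k : ℤ) ∣ d) (hd₂ : ∀ k : ℕ, 1 ≤ k → k ≤ bn b₂ 0 → (k : ℤ) ∣ d)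
    (hd₃ : ∀ k : ℕ, 1 ≤ k → k ≤ bn b₃ 0 → (k : ℤ) ∣ d) :
    ∃ z : ℤ, (d : ℚ) ^ 14 * ((normaliser9 b₁ : ℚ) * normaliser9 b₂ * normaliser9 b₃) * minorP9 b₁ b₂ b₃ = z := by
  obtain ⟨u₁, hu₁⟩ := coeff7_den' h₁ hP₁ hs₁ d hd₁
  obtain ⟨u₂, hu₂⟩ := coeff7_den' h₂ hP₂ hs₂ d hd₂
  obtain ⟨u₃, hu₃⟩ := coeff7_den' h₃ hP₃ hs₃ d hd₃
  obtain ⟨v₁, hv₁⟩ := coeff0_den' h₁ hP₁ hs₁ d hd₁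
  obtain ⟨v₂, hv₂⟩ := coeff0_den' h₂ hP₂ hs₂ d hd₂
  obtain ⟨v₃, hv₃⟩ := coeff0_den' h₃ hP₃ hs₃ d hd₃
  obtain ⟨x₁, hx₁⟩ := coeff3_den' h₁ hP₁ hs₁ d hd₁
  obtain ⟨x₂, hx₂⟩ := coeff3_den' h₂ hP₂ hs₂ d hd₂
  obtain ⟨x₃, hx₃⟩ := coeff3_den' h₃ hP₃ hs₃ d hd₃
  refine ⟨(u₃ * x₂ - u₂ * x₃) * v₁ + (u₁ * x₃ - u₃ * x₁) * v₂ + (u₂ * x₁ - u₁ * x₂) * v₃, ?_⟩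
  rw [minorP9_eq]
  push_cast
  rw [← hu₁, ← hu₂, ← hu₃, ← hv₁, ← hv₂, ← hv₃, ← hx₁, ← hx₂, ← hx₃]
  simp only [cof9]
  ring

/-- Kernel instance of the denominator bound: RAY 1 `β = (3;1⁹)`, the `n`-Casoratian triple `n = 3, 2, 1`
(`b₀ = 9, 6, 3`), `d = d₉ = 2520`: `d⁹ · N₉N₉N₉ · Q ∈ ℤ` (all hypotheses by `decide`). -/
example : ∃ z : ℤ, ((2520 : ℕ) : ℚ) ^ 9 *
    ((normaliser9 (ray9 ![3, 1, 1, 1, 1, 1, 1, 1, 1, 1] 3) : ℚ) * normaliser9 (ray9 ![3, 1, 1, 1, 1, 1, 1, 1, 1, 1] 2) *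
      normaliser9 (ray9 ![3, 1, 1, 1, 1, 1, 1, 1, 1, 1] 1)) *
    minorQ9 (ray9 ![3, 1, 1, 1, 1, 1, 1, 1, 1, 1] 3) (ray9 ![3, 1, 1, 1, 1, 1, 1, 1, 1, 1] 2)
      (ray9 ![3, 1, 1, 1, 1, 1, 1, 1, 1, 1] 1) = z :=
  minorQ9_den ⟨by decide, by decide⟩ ⟨by decide, by decide⟩ ⟨by decide, by decide⟩ (by decide) (by decide) (by decide)
    (by decide) (by decide) (by decide) 2520 (by decide) (by decide) (by decide)

/-! ### 3. The `k = 9` big-prime window laws (CONJECTURES with exact evidence; see the module docstring) -/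

/-- The excess `d₉(b) = 4b₀ − Σ_{j=1}^{9} b_j` (the `k = 9` analogue of `WedgeDictionary.dOf`, `d = 3b₀ − Σ_{j≤7} b_j`). -/
def dNine (b : ℕ → ℤ) : ℤ := 4 * b 0 - ∑ i ∈ range 9, b (i + 1)

/-- Sanity: `d₉(3;1⁹) = 3`, `d₉(20; 9,9,8,8,7,7,6,6,5) = 15`. -/
example : dNine (base9 ![3, 1, 1, 1, 1, 1, 1, 1, 1, 1]) = 3 ∧
    dNine (base9 ![20, 9, 9, 8, 8, 7, 7, 6, 6, 5]) = 15 := by decide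

/-- **CONJECTURE (W)₉ — big-prime window for the `ζ(3)`-coefficient of `F̃₉(b)`** (OBSERVED-EXACT: 7922 pairs `(b,p)` on
788 vectors, 0 failures; upper end sharp in 558/788; `p = 5` fails, see module docstring).  Let `b` lie in the Brown–Zudilin
polytope (`InBox`, `2b_j ≤ b₀`, `Σ b_j ≤ 4b₀`); drop a slot `j₁`, let `j₂ ≠ j₁` be a slot with `b_{j₂} ≤ b_{j₃}` and `j₃` a slot
with `b_{j₃} ≤ b_j` for every other slot `j ∉ {j₁, j₂}` (optimally the three smallest parameters).  Then every prime `p` with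
`max(7, b₀ + 1 − b_{j₂} − b_{j₃}) ≤ p ≤ d₉(b) + 1` satisfies `v_p(coeff3 b) ≥ 1`.  (`k = 9` analogue of the PROVED
`BigPrimeWindow.one_le_padicValRat_coeffW_of_slots`, whose threshold is `7` as well; NOT proved.) -/
@[conjecture] def BigPrime9Zeta3 : Prop :=
  ∀ (b : ℕ → ℤ) (p j₁ j₂ j₃ : ℕ), InBox b → (∀ i ∈ range 9, 2 * b (i + 1) ≤ b 0) →
    ∑ i ∈ range 9, b (i + 1) ≤ 4 * b 0 → j₁ ∈ range 9 → j₂ ∈ range 9 → j₃ ∈ range 9 → j₂ ≠ j₁ →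
    b (j₂ + 1) ≤ b (j₃ + 1) → (∀ j ∈ range 9, j ≠ j₁ → j ≠ j₂ → b (j₃ + 1) ≤ b (j + 1)) →
    p.Prime → 7 ≤ p → b 0 + 1 ≤ (p : ℤ) + b (j₂ + 1) + b (j₃ + 1) → (p : ℤ) ≤ dNine b + 1 →
    coeff3 b ≠ 0 → 1 ≤ padicValRat p (coeff3 b)

/-- **CONJECTURE (U)₉ — big-prime window for the `ζ(5)`-coefficient of `F̃₉(b)`** (OBSERVED-EXACT: 2446 pairs on 656
vectors, 0 failures; upper end sharp in 600/656; `p = 3` fails).  Same slots; every prime `p` with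
`max(5, b₀ + 1 − b_{j₂} − b_{j₃}) ≤ p` and `2p ≤ d₉(b) + 1` satisfies `v_p(coeff5 b) ≥ 1`.  (`k = 9` analogue of the PROVED
`BigPrimeWindow.one_le_padicValRat_coeffU_of_slots`; NOT proved.) -/
@[conjecture] def BigPrime9Zeta5 : Prop :=
  ∀ (b : ℕ → ℤ) (p j₁ j₂ j₃ : ℕ), InBox b → (∀ i ∈ range 9, 2 * b (i + 1) ≤ b 0) →
    ∑ i ∈ range 9, b (i + 1) ≤ 4 * b 0 → j₁ ∈ range 9 → j₂ ∈ range 9 → j₃ ∈ range 9 → j₂ ≠ j₁ →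
    b (j₂ + 1) ≤ b (j₃ + 1) → (∀ j ∈ range 9, j ≠ j₁ → j ≠ j₂ → b (j₃ + 1) ≤ b (j + 1)) →
    p.Prime → 5 ≤ p → b 0 + 1 ≤ (p : ℤ) + b (j₂ + 1) + b (j₃ + 1) → 2 * (p : ℤ) ≤ dNine b + 1 →
    coeff5 b ≠ 0 → 1 ≤ padicValRat p (coeff5 b)

/-- **CONJECTURE (S)₉ — big-prime window for the `ζ(7)`-coefficient of `F̃₉(b)`** (OBSERVED-EXACT: 726 pairs on 524
vectors, 0 failures; upper end sharp in 460/524; no analogue exists at `k = 7`).  Same slots; every prime `p` with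
`max(5, b₀ + 1 − b_{j₂} − b_{j₃}) ≤ p` and `3p ≤ d₉(b) + 1` satisfies `v_p(coeff7 b) ≥ 1`.  NOT proved. -/
@[conjecture] def BigPrime9Zeta7 : Prop :=
  ∀ (b : ℕ → ℤ) (p j₁ j₂ j₃ : ℕ), InBox b → (∀ i ∈ range 9, 2 * b (i + 1) ≤ b 0) →
    ∑ i ∈ range 9, b (i + 1) ≤ 4 * b 0 → j₁ ∈ range 9 → j₂ ∈ range 9 → j₃ ∈ range 9 → j₂ ≠ j₁ →
    b (j₂ + 1) ≤ b (j₃ + 1) → (∀ j ∈ range 9, j ≠ j₁ → j ≠ j₂ → b (j₃ + 1) ≤ b (j + 1)) →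
    p.Prime → 5 ≤ p → b 0 + 1 ≤ (p : ℤ) + b (j₂ + 1) + b (j₃ + 1) → 3 * (p : ℤ) ≤ dNine b + 1 →
    coeff7 b ≠ 0 → 1 ≤ padicValRat p (coeff7 b)

/-- The three windows are simultaneously non-empty on thick directions, e.g. `b = (60; 24⁸, 8)`: `d₉ = 40`, lower end
`61 − 24 − 24 = 13`, so (W)₉ asks `13 ≤ p ≤ 41`, (U)₉ `13 ≤ p ≤ 20`, (S)₉ `p = 13` (all verified exactly, `bp9_b.json`);
here only the arithmetic of the example is checked by the kernel. -/
example : dNine (base9 ![60, 24, 24, 24, 24, 24, 24, 24, 24, 8]) = 40 ∧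
    base9 ![60, 24, 24, 24, 24, 24, 24, 24, 24, 8] 0 + 1 - 24 - 24 = (13 : ℤ) := by decide

end DualSeriesNineMinors

end Summit.KontsevichZagierPeriods.Zeta5Search
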